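import Summits.RiemannHypothesis.RiemannHypothesis.Theorems.GroundBartaEvenWinsBeyondArchDeflationM72OddLower
import Summits.RiemannHypothesis.RiemannHypothesis.Theorems.GroundBartaEvenWinsBeyondArchDeflationM75OddLower
import Summits.RiemannHypothesis.RiemannHypothesis.Theorems.WeilParityEvenWinsBeyondArchFrontier75OfOddLower
import HarnessLib

/-!
# RiemannHypothesis / GroundBarta — rung 4: `WeilWindowSimpleEven` on `(0, 3/4]` (cells `[2/3,18/25]`, `[18/25,3/4]` closed)

Helper file (`--supports stmt-RiemannHypothesis-18085`), RH-free.  Prover A (gen 2) with prover B's R-layers.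
The two certified odd-sector lower bounds `m72_oddLower_lit` (`1.1·10⁻¹¹ ≤ ε_od(18/25)`) and `m75_oddLower_lit`
(`1.3·10⁻¹³ ≤ ε_od(3/4)`) fed to the cell transfer `weilWindowSimpleEven_of_le_M75_of_oddLower`.
-/

set_option linter.dupNamespace false

noncomputable section

namespace Summit.RiemannHypothesis.RiemannHypothesis.Theorems.EvenWinsBeyondArch

open Literature.NumberTheory.LFunctions

/-- **`WeilWindowSimpleEven a` for every `0 < a ≤ 3/4`**: the Weil-form ground state on `[-a, a]` is simple, isolated
and even, and `ε_ev(a) < ε_od(a)` — the parity ladder now reaches `3/4 > log 2`. [folklore] -/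
theorem weilWindowSimpleEven_upTo_M75 : ∀ a : ℝ, 0 < a → a ≤ 3 / 4 → WeilWindowSimpleEven a :=
  weilWindowSimpleEven_of_le_M75_of_oddLower m72_oddLower_lit.1 m72_oddLower_lit.2 m75_oddLower_lit.1 m75_oddLower_lit.2

/-- The tail shape of item 18085 up to `3/4`: `log 2 < a ≤ 3/4 ⟹ WeilWindowSimpleEven a`. [folklore] -/
theorem tailSimpleEven_upTo_M75 : ∀ a : ℝ, Real.log 2 < a → a ≤ 3 / 4 → WeilWindowSimpleEven a :=
  fun a ha hle ↦ weilWindowSimpleEven_upTo_M75 a ((Real.log_pos (by norm_num)).trans ha) hle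

end Summit.RiemannHypothesis.RiemannHypothesis.Theorems.EvenWinsBeyondArch

end
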